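import Summits.BirchSwinnertonDyer.BirchSwinnertonDyer.Theorems.CMKolyvaginAtInertTwoRationalDescentAtTwoLevelZero
import Summits.BirchSwinnertonDyer.BirchSwinnertonDyer.Theorems.CMKolyvaginAtInertTwoCMExactDescentAtTwo
import Summits.BirchSwinnertonDyer.BirchSwinnertonDyer.Theorems.CMKolyvaginAtInertTwoCMPrimitiveSupplyAtInertTwoOfKolyvaginConjecture
import HarnessLib

/-!
# Route `CMKolyvaginAtInertTwo`, crux `CMKolyvaginExactAtInertTwo` (stmt-BirchSwinnertonDyer-24277):
# THE LEVEL-ZERO CLASS THEOREM — on H₂ with a PRIME Heegner field and a 2-indivisible `y_K`,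
# `BSD₂(E)` follows from PRINT + the point-system DATA `D` + the two PLUMBING binders

Seat `bsd-line-cmk2-p1` g9 (cell `bsd-print-cf2`); helper (`--supports stmt-BirchSwinnertonDyer-24277`).
THEOREMS ONLY (no definition, no named fact, no instance, no `sorry`); no item is closed; BSD is not
proved by this. This is the assembly the pen's booking memo (`BOOKING-TARGET-H2-levelzero.md` v2 §§2–3,
planner g13) describes, as a helper on the CMK crux; PrintCf2 books from its TYPE only once the DATA `D`
(item (0b)₂¹) and the plumbing are theorems.

THE CHAIN (all by name): the route's frame `(Dt, β, ι, d₁)` with `y_K = d₁.derivedPoint ∈ E(K[1])` of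
infinite order and NOT `2`-divisible in `E(K[1])` (the cruxes' clause at `M₀ = 0`) ⟶ a Heegner point
`P₀ ∈ E(K)` of level `N_E` below it, `P₀ ∉ 2E(K)` by functoriality
(`CMExactDescent.exists_heegnerPoint_map_eq_derivedPoint_one`) ⟶ `#Ш(E/K)[2^∞] = 1`
(`KolyvaginRatDescentTwo.natCard_primaryComponent_sha_two_eq_one_of_cmInert_prime_discr_of_pointSystem`,
p635044: Poitou–Tate, Čebotarev and the reciprocity family are tree theorems; inputs left = `D`, (tower),
(desc-fin)) ⟶ `L(E^{(d_K)}, 1) ≠ 0` (`y_K` non-torsion + Gross–Zagier + `L′(E/K,1) = L′(E,1)·L(E^{(d_K)},1)`)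
⟶ a globally minimal twin `Wd ≅ E^{(d_K)}` with CM and `r_an = 0`
(`CMSupply.exists_minimal_twin_hasCM_analyticRank_zero`) and `BSD₂(Wd)` by Burungale–Flach
(`Rank1Residual.bsdp_cm_rankZero`) ⟶ `BSD₂(E)` by the closed descent crux
(`CMExactDescent.cmExactDescentAtTwo_of_facts`, item 24154, with `#Ш = 2^{2·0}`).

* `bsdp_two_of_levelZero_primeHeegner_of_pointSystem_of_plumbing` — PRINT (`exists_isNewformOf`, Gross–Zagier
  at every level, `rank_eq_analyticRank_of_analyticRank_le_one`, Milne any-model,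
  `bsdTriple_of_hasCM_of_L_one_ne_zero`) → ∀ `W` ∈ H₂ (`HasCM`, `CMInert W 2`, `ρ̄₂` onto, `r_an = 1`,
  odd Tamagawa product) → ∀ `K` imaginary quadratic with `d_K = −q`, `q` prime, `d_K` odd `≠ −3`, Heegner
  for `N_E` (with the place `u` of `q`) → ∀ `Dt` (lattice clause, `Odd Dt.c`), `β`, `ι`, `d₁` with
  `y_K` of infinite order, `y_K ∉ 2E(K[1])` → [DATA: a `p = 2` point system on the CM-inert Kolyvagin
  primes for every Heegner point of level `N_E` over `K`] → [(tower), (desc-fin)] → `BSDp W 2`.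

HONEST FRAMING: conditional on the displayed prints (none of the five has a `_holds`), on the DATA `D`
(Gross §§4–6 / McCallum §4 at `p = 2` for CM curves: not print, not in the tree — item (0b)) and on the
two plumbing binders (ty2 g22). Beyond print: NO while `D` is a hypothesis. BSD is not proved by this; no
summit statement and no item is closed by this file.

References: [GrossLMS1991] §1 (1.2), Prop. 2.1, §4 (4.1), Props. 5.4, 6.2, §10; [McCallumLMS1991] §1,
§2 Prop. 2.2, §5; [GrossZagier1986] I.6.3, V.§2; [BurungaleFlach2024] Thm. 1.1, Cor. 2; [Milne1972] Thm. 1;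
[MilneADT2006] I Thm. 4.10 (b); [SilvermanAEC2009] X Thm. 4.2 (a).
-/

-- single-conjunct summit: `Summit.BirchSwinnertonDyer.BirchSwinnertonDyer.…` repeats the name by design
set_option linter.dupNamespace false
set_option autoImplicit false

noncomputable section

open scoped Classical
open WeierstrassCurve NumberField IsDedekindDomain
open Literature.NumberTheory.EllipticCurves Literature.NumberTheory.EllipticCurves.ModularForms
open Literature.NumberTheory.EllipticCurves.Rank1Residual
open Literature.NumberTheory.EllipticCurves.KrizLi2019
open Literature.NumberTheory.GaloisRepresentations
open Rat.HeightOneSpectrum (primesEquiv)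

namespace Summit.BirchSwinnertonDyer.BirchSwinnertonDyer.Theorems.CMLevelZeroTwo

/-- **THE LEVEL-ZERO CLASS THEOREM on H₂ for a prime Heegner field** (see the module docstring for the
chain): from the five PRINT facts, the `p = 2` point-system DATA `D` for the Heegner points of level `N_E`
over `K` (CM-inert support) and the two PLUMBING binders (tower), (desc-fin), every `W ∈ H₂` with a prime
Heegner field `K = ℚ(√−q)` and a frame whose `y_K` has infinite order and is not `2`-divisible in
`E(K[1])` satisfies `BSD₂`. [cite: GrossLMS1991, §1 (1.2), Prop. 2.1 with §10, Props. 5.4, 6.2]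
[cite: McCallumLMS1991, §1 Theorem, §2 Prop. 2.2, §5 Lemma 5.1] [cite: GrossZagier1986, Thm. I.6.3, V.§2 (pp. 310–312)]
[cite: BurungaleFlach2024, Thm. 1.1 and Cor. 2] [cite: Milne1972ArithmeticAV, §1 Thm. 1] -/
theorem bsdp_two_of_levelZero_primeHeegner_of_pointSystem_of_plumbing (hmod : exists_isNewformOf)
    (hGZ : ∀ (N : ℕ) [NeZero N] (W : WeierstrassCurve ℚ) (K : Type) [Field K] [NumberField K],
      gross_zagier N W K)
    (hGZK : rank_eq_analyticRank_of_analyticRank_le_one)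
    (hMilne : Milne1972.bsdQuotient_baseChange_quadratic_anyModel)
    (hBF : bsdTriple_of_hasCM_of_L_one_ne_zero)
    (W : WeierstrassCurve ℚ) [W.IsElliptic] [W.IsGloballyMinimal] [NeZero (W.conductorNorm ℤ)]
    (hCM : W.HasCM) (hin : CMInert W 2) (hsurj : W.HasSurjectiveModNGaloisRep (2 : ℤ))
    (hr : W.analyticRank = 1) (hT : Odd W.tamagawaProduct)
    (K : Type) [Field K] [NumberField K] (hK : IsImaginaryQuadratic K) (hodd : Odd (discr K))
    (h3 : discr K ≠ -3) (hH : SatisfiesHeegnerHypothesis (W.conductorNorm ℤ) K)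
    {q : ℕ} (hq : q.Prime) (hd : discr K = -(q : ℤ))
    (u : HeightOneSpectrum (𝓞 ℚ)) (hu : ((primesEquiv u : Nat.Primes) : ℕ) = q)
    (Dt : ModularParametrizationData W (W.conductorNorm ℤ))
    (hopt : ∀ z ∈ Dt.L.lattice, ∃ w ∈ periodLattice Dt.f, z = (Dt.c : ℂ) * w) (hc : Odd Dt.c)
    (β : ℤ) (ι : K →+* ℂ) (d₁ : KolyvaginHeegnerData Dt β ι 1) (hy : ¬ IsOfFinAddOrder d₁.derivedPoint)
    (h2 : ¬ ∃ Q : (W.baseChange (ringClassField K ι 1)).toAffine.Point, (2 : ℤ) • Q = d₁.derivedPoint)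
    (D : ∀ P₀ : (W.baseChange K).toAffine.Point, IsHeegnerPoint (W.conductorNorm ℤ) W K P₀ →
      Rank1Residual.P2.KolyvaginMachine.PointSystemFamily (W.conductorNorm ℤ) W K P₀ 2 (CMInert W))
    (htower : ∀ (w : HeightOneSpectrum (𝓞 K)) (ξ : galH1Torsion W ((2 ^ 1 : ℕ) : ℤ)),
      ξ ∈ W.torsionLocalKer ((w.under (𝓞 ℚ)).adicCompletion ℚ) ((2 ^ 1 : ℕ) : ℤ) →
        resTorsion W K ((2 ^ 1 : ℕ) : ℤ) ξ ∈
          (W.baseChange K).torsionLocalKer (w.adicCompletion K) ((2 ^ 1 : ℕ) : ℤ))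
    (hdescfin : ∀ (ξ : galH1Torsion W ((2 ^ 1 : ℕ) : ℤ)) (v : HeightOneSpectrum (𝓞 ℚ)), v ≠ u →
      (∀ w : HeightOneSpectrum (𝓞 K), w.under (𝓞 ℚ) = v →
        resTorsion W K ((2 ^ 1 : ℕ) : ℤ) ξ ∈
          selmerLocalKer (W.baseChange K) (w.adicCompletion K) ((2 ^ 1 : ℕ) : ℤ)) →
      ξ ∈ selmerLocalKer W (v.adicCompletion ℚ) ((2 ^ 1 : ℕ) : ℤ)) :
    BSDp W 2 := by
  haveI : Fact (Nat.Prime 2) := ⟨Nat.prime_two⟩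
  haveI hEK : (W.baseChange K).IsElliptic := inferInstanceAs (W.map (algebraMap ℚ K)).IsElliptic
  have hL : hasEntireLFunction_rat := hasEntireLFunction_rat_of_exists_isNewformOf hmod
  have hD0 : (discr K : ℚ) ≠ 0 := by exact_mod_cast NumberField.discr_ne_zero K
  haveI hEt : (W.quadraticTwist (discr K : ℚ)).IsElliptic := W.isElliptic_quadraticTwist hD0
  -- the Heegner point `P₀ ∈ E(K)` below `y_K = P(1)`, not `2`-divisible in `E(K)`, of infinite order
  obtain ⟨P₀, Hd, hP₀, hP₀K⟩ := CMExactDescent.exists_heegnerPoint_map_eq_derivedPoint_one hK hH d₁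
  have hheeg : IsHeegnerPoint (W.conductorNorm ℤ) W K P₀ := ⟨Dt, Hd, ι, hP₀⟩
  have hy2 : ∀ Q : (W.baseChange K).toAffine.Point, 2 • Q ≠ P₀ := by
    intro Q hQ
    refine h2 ⟨WeierstrassCurve.Affine.Point.map (W' := W)
      (algebraMap K (ringClassField K ι 1)).toRatAlgHom Q, ?_⟩
    rw [two_zsmul, ← map_add, ← two_nsmul, hQ, hP₀K]
  have hPinf : ¬ IsOfFinAddOrder P₀ := by
    intro hfin
    apply hy
    rw [← hP₀K]
    exact (WeierstrassCurve.Affine.Point.map (W' := W)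
      (algebraMap K (ringClassField K ι 1)).toRatAlgHom).isOfFinAddOrder hfin
  -- `#Ш(E/K)[2^∞] = 1 = 2^{2·0}` — the `M₀ = 0` case of the crux, modulo `D`, (tower), (desc-fin)
  have hsha1 : Nat.card (AddCommGroup.primaryComponent (W.baseChange K).sha 2) = 1 :=
    KolyvaginRatDescentTwo.natCard_primaryComponent_sha_two_eq_one_of_cmInert_prime_discr_of_pointSystem
      W hCM hin hsurj hK hodd hH hq hd u hu hheeg hy2 (D P₀ hheeg) htower hdescfin
  have hsha : Nat.card (AddCommGroup.primaryComponent (W.baseChange K).sha 2) = 2 ^ (2 * 0) := by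
    rw [hsha1, mul_zero, pow_zero]
  -- the twin: `L(E^{(d_K)}, 1) ≠ 0` from `y_K` non-torsion, Gross–Zagier and the product rule
  have hLK : LDerivEK W K ≠ 0 :=
    (lDerivEK_ne_zero_iff_not_isOfFinAddOrder W (W.conductorNorm ℤ) K (hGZ _ W K) hK hH hheeg).mpr hPinf
  have hL0 : W.entireLFunction 1 = 0 := entireLFunction_one_eq_zero_of_analyticRank_eq_one hr
  have hLt : (W.quadraticTwist (discr K : ℚ)).entireLFunction 1 ≠ 0 := by
    intro h0
    apply hLK
    rw [lDerivEK_eq_deriv_mul W K hL hL0, h0, mul_zero]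
  obtain ⟨Wd, _, _, hWd, hcmd, hrd⟩ := CMSupply.exists_minimal_twin_hasCM_analyticRank_zero hmod W hCM K hLt
  have hBd : BSDp Wd 2 := Summit.BirchSwinnertonDyer.Rank1Residual.bsdp_cm_rankZero (p := 2) hBF hL hcmd hrd
  -- the divisibility clauses at `M₀ = 0`
  have hdiv0 : ∃ Q : (W.baseChange (ringClassField K ι 1)).toAffine.Point,
      ((2 ^ 0 : ℕ) : ℤ) • Q = d₁.derivedPoint :=
    ⟨d₁.derivedPoint, by rw [pow_zero, Nat.cast_one, one_smul]⟩
  have hndiv0 : ¬ ∃ Q : (W.baseChange (ringClassField K ι 1)).toAffine.Point,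
      ((2 ^ (0 + 1) : ℕ) : ℤ) • Q = d₁.derivedPoint := by
    rwa [zero_add, pow_one, Nat.cast_ofNat]
  -- the closed descent crux (item 24154's content)
  exact CMExactDescent.cmExactDescentAtTwo_of_facts hGZ hGZK hL hMilne W hCM hin hsurj hr hT K hK hodd h3 hH
    Dt hopt hc β ι d₁ hy 0 hdiv0 hndiv0 hsha Wd hWd hBd

end Summit.BirchSwinnertonDyer.BirchSwinnertonDyer.Theorems.CMLevelZeroTwo

end
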